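import Mathlib

/-!
# Crux `CoreGluingGivenInvertibilityQR`, line `Sketch`, stub `stub_qrDampedSectorBound`

Two-sided maximum principle for a damped swept sector: a bounded `C²` solution of
`−η″ + w η′ + a η = f` on `ℝ` with damping `a ≥ a₀ > 0`, sweep `|w τ| ≤ C (1 + |τ|)` and
forcing `|f| ≤ F` satisfies `a₀ |η| ≤ F`, with no condition at either end.

Proof: penalise with the barrier `ε log (1 + τ²)`; the penalised function tends to `−∞` away from
compact sets, so it attains a global maximum, where the first derivative vanishes and the second
derivative is nonpositive; the equation there gives `a₀ η ≤ F + O(ε)` everywhere; let `ε → 0` and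
apply the one-sided bound to `η` and to `−η`.  Only the pointwise equation is used (`w`, `a`, `f`
need not be continuous).
-/

set_option linter.dupNamespace false

noncomputable section

namespace Summit.NavierStokesRegularity.NavierStokesRegularity.Theorems

open MeasureTheory Real Set Filter Topology
open scoped InnerProductSpace

/-- At a local maximum of a real function continuous at the point, the second derivative (in the
`deriv ∘ deriv` sense, with the junk-value conventions of `deriv`) is nonpositive. -/
theorem qrDamped_deriv_deriv_nonpos_of_isLocalMax {g : ℝ → ℝ} {t : ℝ} (hc : ContinuousAt g t)
    (hmax : IsLocalMax g t) : deriv (deriv g) t ≤ 0 := by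
  refine not_lt.mp fun h => ?_
  have hd : deriv g t = 0 := hmax.deriv_eq_zero
  have hmin : IsLocalMin g t := isLocalMin_of_deriv_deriv_pos h hd hc
  have hconst : g =ᶠ[𝓝 t] fun _ => g t := by
    filter_upwards [hmax, hmin] with s hs1 hs2
    exact le_antisymm hs1 hs2
  have h0 : deriv (deriv g) t = 0 := by
    rw [hconst.deriv.deriv_eq]
    simp
  exact absurd h0 (ne_of_gt h)

/-- Derivative of the barrier `τ ↦ log (1 + τ²)`. -/
theorem qrDamped_hasDerivAt_logBarrier (x : ℝ) :
    HasDerivAt (fun y : ℝ => Real.log (1 + y ^ 2)) (2 * x / (1 + x ^ 2)) x := by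
  have h1 : HasDerivAt (fun y : ℝ => 1 + y ^ 2) (2 * x) x := by
    simpa using (hasDerivAt_pow 2 x).const_add 1
  exact h1.log (by positivity)

/-- Derivative of `τ ↦ 2τ / (1 + τ²)`, the derivative of the barrier. -/
theorem qrDamped_hasDerivAt_logBarrier_deriv (x : ℝ) :
    HasDerivAt (fun y : ℝ => 2 * y / (1 + y ^ 2))
      ((2 * (1 + x ^ 2) - 2 * x * (2 * x)) / (1 + x ^ 2) ^ 2) x := by
  have h1 : HasDerivAt (fun y : ℝ => 2 * y) 2 x := by
    simpa using (hasDerivAt_id x).const_mul 2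
  have h2 : HasDerivAt (fun y : ℝ => 1 + y ^ 2) (2 * x) x := by
    simpa using (hasDerivAt_pow 2 x).const_add 1
  exact h1.fun_div h2 (by positivity)

/-- **One-sided bound.** Under the hypotheses of `stub_qrDampedSectorBound`, `a₀ η τ₀ ≤ F` for every
`τ₀` (maximum principle with the barrier `ε log (1 + τ²)`, then `ε → 0`). -/
theorem qrDamped_oneSided {a₀ C F : ℝ} {w a η f : ℝ → ℝ} (ha₀ : 0 < a₀) (ha : ∀ τ, a₀ ≤ a τ)
    (hw : ∀ τ, |w τ| ≤ C * (1 + |τ|)) (hf : ∀ τ, |f τ| ≤ F) (hη : ContDiff ℝ 2 η)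
    (hB : ∃ B, ∀ τ, |η τ| ≤ B)
    (heq : ∀ τ, -(deriv (deriv η) τ) + w τ * deriv η τ + a τ * η τ = f τ) (τ₀ : ℝ) :
    a₀ * η τ₀ ≤ F := by
  obtain ⟨B, hB⟩ := hB
  have hC : 0 ≤ C := by
    have h := hw 0
    simp only [abs_zero, add_zero, mul_one] at h
    exact (abs_nonneg _).trans h
  have hF : 0 ≤ F := (abs_nonneg _).trans (hf 0)
  have hd0 : Differentiable ℝ η := hη.differentiable (by norm_num)
  have hd1 : Differentiable ℝ (deriv η) := by
    have h := hη.differentiable_iteratedDeriv 1 (by norm_num)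
    rwa [iteratedDeriv_one] at h
  have hcont : Continuous η := hη.continuous
  -- the barrier `L τ = log (1 + τ²)`
  obtain ⟨L, hL⟩ : ∃ L : ℝ → ℝ, L = fun y => Real.log (1 + y ^ 2) := ⟨_, rfl⟩
  have hL0 : ∀ y, 0 ≤ L y := by
    intro y
    rw [hL]
    exact Real.log_nonneg (by nlinarith [sq_nonneg y])
  have hLd : ∀ y, HasDerivAt L (2 * y / (1 + y ^ 2)) y := by
    rw [hL]
    exact qrDamped_hasDerivAt_logBarrier
  have hLc : Continuous L := continuous_iff_continuousAt.2 fun y => (hLd y).continuousAt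
  have hLlim : Tendsto L (cocompact ℝ) atTop := by
    have h1 : Tendsto (fun y : ℝ => ‖y‖ ^ 2) (cocompact ℝ) atTop :=
      (tendsto_pow_atTop two_ne_zero).comp tendsto_norm_cocompact_atTop
    have h2 : Tendsto (fun y : ℝ => y ^ 2) (cocompact ℝ) atTop := by
      refine h1.congr fun y => ?_
      simp
    have h3 : Tendsto (fun y : ℝ => 1 + y ^ 2) (cocompact ℝ) atTop :=
      tendsto_atTop_add_const_left _ 1 h2
    rw [hL]
    exact Real.tendsto_log_atTop.comp h3
  -- key estimate: for every `ε > 0`, `a₀ η τ₀ ≤ F + ε K(τ₀)`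
  have key : ∀ ε : ℝ, 0 < ε → a₀ * η τ₀ ≤ F + ε * (2 + 4 * C + a₀ * L τ₀) := by
    intro ε hε
    have hgc : Continuous fun y => η y - ε * L y := hcont.sub (continuous_const.mul hLc)
    have hgd : ∀ y, HasDerivAt (fun y => η y - ε * L y) (deriv η y - ε * (2 * y / (1 + y ^ 2))) y :=
      fun y => (hd0 y).hasDerivAt.fun_sub ((hLd y).const_mul ε)
    have hgd' : deriv (fun y => η y - ε * L y) = fun y => deriv η y - ε * (2 * y / (1 + y ^ 2)) :=
      funext fun y => (hgd y).deriv
    have hg2 : ∀ y, HasDerivAt (deriv fun y => η y - ε * L y)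
        (deriv (deriv η) y - ε * ((2 * (1 + y ^ 2) - 2 * y * (2 * y)) / (1 + y ^ 2) ^ 2)) y := by
      intro y
      rw [hgd']
      exact (hd1 y).hasDerivAt.fun_sub ((qrDamped_hasDerivAt_logBarrier_deriv y).const_mul ε)
    -- the penalised function tends to `-∞` away from compact sets, hence has a global maximum
    have hglim : Tendsto (fun y => η y - ε * L y) (cocompact ℝ) atBot := by
      have h1 : Tendsto (fun y => -(ε * L y)) (cocompact ℝ) atBot :=
        tendsto_neg_atTop_atBot.comp (hLlim.const_mul_atTop hε)
      have h2 : Tendsto (fun y => η y + -(ε * L y)) (cocompact ℝ) atBot :=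
        tendsto_atBot_add_left_of_ge _ B (fun y => (abs_le.mp (hB y)).2) h1
      simpa only [sub_eq_add_neg] using h2
    obtain ⟨t, ht⟩ := hgc.exists_forall_ge hglim
    have hlocmax : IsLocalMax (fun y => η y - ε * L y) t := Filter.Eventually.of_forall ht
    -- first- and second-order conditions at the maximiser
    have h1 : deriv η t = ε * (2 * t / (1 + t ^ 2)) := by
      have h := hlocmax.deriv_eq_zero
      rw [(hgd t).deriv] at h
      linarith
    have h2 : deriv (deriv η) t ≤
        ε * ((2 * (1 + t ^ 2) - 2 * t * (2 * t)) / (1 + t ^ 2) ^ 2) := by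
      have h := qrDamped_deriv_deriv_nonpos_of_isLocalMax hgc.continuousAt hlocmax
      rw [(hg2 t).deriv] at h
      linarith
    -- elementary bounds on the barrier derivatives
    have hpos : 0 < 1 + t ^ 2 := by positivity
    have hD2 : (2 * (1 + t ^ 2) - 2 * t * (2 * t)) / (1 + t ^ 2) ^ 2 ≤ 2 := by
      rw [div_le_iff₀ (by positivity)]
      nlinarith [sq_nonneg t, sq_nonneg (t ^ 2)]
    have hD1 : (1 + |t|) * |2 * t / (1 + t ^ 2)| ≤ 4 := by
      rw [abs_div, abs_mul, abs_two, abs_of_pos hpos, mul_div_assoc', div_le_iff₀ hpos]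
      nlinarith [abs_nonneg t, sq_abs t, sq_nonneg (|t| - 1)]
    -- the terms of the equation at the maximiser
    have hf_t : f t ≤ F := (le_abs_self _).trans (hf t)
    have hdd : deriv (deriv η) t ≤ 2 * ε := by
      have := mul_le_mul_of_nonneg_left hD2 hε.le
      linarith
    have hwd : -(w t * deriv η t) ≤ 4 * C * ε := by
      have e1 : |w t * deriv η t| ≤ 4 * C * ε := by
        rw [abs_mul, h1, abs_mul, abs_of_pos hε]
        calc |w t| * (ε * |2 * t / (1 + t ^ 2)|)
            ≤ C * (1 + |t|) * (ε * |2 * t / (1 + t ^ 2)|) :=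
              mul_le_mul_of_nonneg_right (hw t) (by positivity)
          _ = C * ε * ((1 + |t|) * |2 * t / (1 + t ^ 2)|) := by ring
          _ ≤ C * ε * 4 := mul_le_mul_of_nonneg_left hD1 (by positivity)
          _ = 4 * C * ε := by ring
      have := neg_abs_le (w t * deriv η t)
      linarith
    have hat : a t * η t ≤ F + ε * (2 + 4 * C) := by
      have e := heq t
      linarith
    -- compare `τ₀` with the maximiser
    have hcomp : η τ₀ ≤ η t + ε * L τ₀ := by
      have e : η τ₀ - ε * L τ₀ ≤ η t - ε * L t := ht τ₀
      have := mul_nonneg hε.le (hL0 t)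
      linarith
    have e2 : a₀ * η τ₀ ≤ a₀ * (η t + ε * L τ₀) := mul_le_mul_of_nonneg_left hcomp ha₀.le
    have hL0' := mul_nonneg hε.le (hL0 τ₀)
    rcases le_or_gt 0 (η t) with hpos' | hneg
    · have e1 : a₀ * η t ≤ a t * η t := mul_le_mul_of_nonneg_right (ha t) hpos'
      nlinarith [e1, e2, hat, hL0']
    · have e3 : a₀ * η t < 0 := mul_neg_of_pos_of_neg ha₀ hneg
      nlinarith [e2, e3, hL0', mul_nonneg hε.le hC, hF]
  -- let `ε → 0`
  refine le_of_forall_pos_le_add fun δ hδ => ?_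
  have hK0 : 0 ≤ 2 + 4 * C + a₀ * L τ₀ := by
    have := mul_nonneg ha₀.le (hL0 τ₀)
    linarith
  have hK1 : 0 < 2 + 4 * C + a₀ * L τ₀ + 1 := by linarith
  have h := key (δ / (2 + 4 * C + a₀ * L τ₀ + 1)) (div_pos hδ hK1)
  have h' : δ / (2 + 4 * C + a₀ * L τ₀ + 1) * (2 + 4 * C + a₀ * L τ₀) ≤ δ := by
    rw [div_mul_eq_mul_div, div_le_iff₀ hK1]
    nlinarith
  linarith

/-- **Stub (damped swept sector, two-sided bound).** A bounded `C²` solution of `−η″ + w η′ + a η = f`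
on `ℝ` with damping `a ≥ a₀ > 0`, sweep of at most linear growth and bounded forcing obeys
`a₀ |η| ≤ sup |f|`, with no condition at either end (maximum principle with the barrier
`ε log(1+τ²)`, applied to `η` and to `−η`). [folklore] -/
theorem stub_qrDampedSectorBound :
    ∀ (a₀ C F : ℝ) (w a η f : ℝ → ℝ), 0 < a₀ → (∀ τ, a₀ ≤ a τ) → (∀ τ, |w τ| ≤ C * (1 + |τ|)) →
      (∀ τ, |f τ| ≤ F) → ContDiff ℝ 2 η → (∃ B, ∀ τ, |η τ| ≤ B) →
      (∀ τ, -(deriv (deriv η) τ) + w τ * deriv η τ + a τ * η τ = f τ) →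
      ∀ τ, a₀ * |η τ| ≤ F := by
  intro a₀ C F w a η f ha₀ ha hw hf hη hB heq τ
  have h1 : a₀ * η τ ≤ F := qrDamped_oneSided ha₀ ha hw hf hη hB heq τ
  have hB' : ∃ B, ∀ τ, |(-η τ)| ≤ B := by
    obtain ⟨B, hB⟩ := hB
    exact ⟨B, fun x => by simpa using hB x⟩
  have hf' : ∀ τ, |(-f τ)| ≤ F := fun x => by simpa using hf x
  have heq' : ∀ τ, -(deriv (deriv fun x => -η x) τ) + w τ * deriv (fun x => -η x) τ
      + a τ * (-η τ) = -f τ := by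
    intro x
    have e1 : deriv (fun x => -η x) = fun x => -deriv η x := funext fun x => deriv.neg
    have e2 : deriv (fun x => -deriv η x) = fun x => -deriv (deriv η) x :=
      funext fun x => deriv.neg
    rw [e1, e2]
    linarith [heq x]
  have h2 : a₀ * (-η τ) ≤ F := qrDamped_oneSided ha₀ ha hw hf' hη.neg hB' heq' τ
  rcases abs_cases (η τ) with ⟨h, _⟩ | ⟨h, _⟩ <;> rw [h] <;> linarith

end Summit.NavierStokesRegularity.NavierStokesRegularity.Theorems
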